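import Summits.QuantumFields.BalabanUV.T4Continuum.Support.B13RepresentsOn
import Summits.QuantumFields.BalabanUV.T4Continuum.Support.B13StepOfRecord
import Summits.QuantumFields.BalabanUV.T4Continuum.Support.B13OpMeasurable

/-!
# NE5 ∕ U3 — row O1-e on the CARRIERS OF RECORD OVER AN ARBITRARY OPERATOR CARRIER, and THE SLOTS OF RECORD ON A SUB-SLOT
# `M ≤ OpDatum E` (owner RULING R20, journal `CLAIMS.log` l.11032: «re-instantiate the P1 step model of record over a measurable
# operator carrier `Op′`; of record `Op′ := ↥(B13OpMeasurable.measOp …)`, `rd := subtypeL`»)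

Cell `pub-balaban`, unit `b2b-balaban-t4-ne5-formalise-leaf-03` (NE5 formalisation swarm, LEAF PROVER 03, gen 6; INTENT `CLAIMS.log`
l.11190 under CLAIM RULE 1 — follower of leaf-09's `B13StepOfRecord` p208933, custody leaf-09 by R20, written by leaf-03 after the stated
hold-off with hand-over offered).  Summits-side new work under the LEAN PLACEMENT RULE (cell bookkeeping; NOT a Literature module).
HONEST FRAMING: rung (B)+1 of the FINITE-VOLUME T⁴ continuum programme — NOT infinite volume, NOT a mass gap, NOT the Clay problem, NOT
a proof of NE5 (NOT PRINTED in [Balaban1987RG1]–[Balaban1989LargeFieldII]; they print ε-UNIFORM bounds, never η-RATES).  HONEST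
DEPENDENCY (cell line, verbatim): continuum YM on T⁴ ⇐ BetaPertH ∧ nine spine estimates (0/9 proved); BetaPertH ⇐ (D1) ∧ (D4) ∧
CAP+tail; G-an2-4 gates asym, D1 and NE2/3/4.

WHAT THIS FILE DOES (R20 (i), AT THE MODEL LEVEL, POLYMORPHIC).
* §1 `SlotsOn R Op IOp Hist` — leaf-09's `Slots` with the operator slot an ARBITRARY complex normed space `Op` (activity terms
  `act : R.carriers.Dom → InnerLabel … → Op → Hist → ℂ`, operator data `opA`∕`opB` IN `Op`, insertion datum, margins); `assemblyOn S`
  (term indexing `labelsIndexing (domainGeometry R) (b13InnerData R)` and hard core `touchInc (domainGeometry R)` OF RECORD),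
  **`stepOn S E₀ cB : StepModel R.carriers Op Hist`**, `outA`∕`outB`; L01∕L02∕L03, the structure binders and the levelwise output on
  the carriers of record — one-line specialisations of `B13RepresentsOn.AssemblyOn.*`.
* §2 **THE SLOTS OF RECORD ON A SUB-SLOT**: for `S₀ : B13StepOfRecord.Slots R E IOp Hist` and a ℂ-submodule `M ≤ OpDatum E` CONTAINING
  THE OPERATOR DATA OF RECORD (`opOf S₀.F S₀.rawA g V k ∈ M`, `opOf S₀.F S₀.rawB g U k ∈ M` — one-run side conditions), `onSub S₀ M hA hB
  act : SlotsOn R ↥M IOp Hist` (cores `act` typed ON `↥M`; operator data coerced into `M`; reading `rd := M.subtypeL`), and `restrict S₀ M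
  hA hB` (cores := `S₀.act` read through the inclusion).  IDENTIFICATIONS, all `rfl`∕`Iff.rfl`: the reading returns the data of record
  (`subtypeL_opA`∕`subtypeL_opB`), `bHist`∕`histRef`∕`TransportReads`∕`SliceBudgetB`∕`SliceBudget`∕`InsertionRate`∕`InsScaleBound` are
  those of `B13StepOfRecord.step S₀ E₀ cB`; `OperatorRate` transfers both ways (isometric inclusion) and is PRODUCED from row NE2's
  entry currency along the reading (`operatorRate_onSub_of_weightedEntrywise`); the budget-box base corresponds under the inclusion
  (`mem_base_onSub_iff`); and for `restrict`: **`outA_restrict`∕`outB_restrict` — the two runs' outputs ARE `B13StepOfRecord.outA∕outB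
  S₀ E₀ cB`** (the recursion (2.13) reads `Out` only at the model's own operator data, which lie in `M`).
* §3 OF RECORD (R20): `M := B13OpMeasurable.measOp T κ ι Ω 𝒴` for `E := Species T κ ι Ω 𝒴` — membership of both runs' data of
  record from measurable `x`-sections of the raw species on the potential species and measurable potential weights of the formats
  (route P2's `assemble_mem_measOp` BY NAME): `opA_mem_measOp`∕`opB_mem_measOp`, `onMeasOp`, `restrictMeasOp`.
CONSUMERS (R20): leaf-08's `B13TermDataOpSecantM` and the O1-d2-ii `TermGaussianParamBi` instance (R18) on `Op := ↥measOp`; the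
polymorphic END faces (E1∕E8∕E9 producers, `OutputRate*`) apply to `stepOn` UNCHANGED; leaf-01∕leaf-03 re-point E8[rec]∕E9[rec].
WHAT IS *NOT* HERE (honest).  No estimate; nothing of [II]'s kernels∕potentials∕terms is asserted (the `SlotsOn` stay PARAMETERS);
the G-ne5p2-5∕R20 caveat is LIFTED only in the sense that operator-ball binders over `↥M` are satisfiable in principle — none is
discharged here.  `BetaPertH`, (B), (B^μ) absent.  0 sorry; axioms ⊆ {propext, Classical.choice, Quot.sound}.
-/

noncomputable section

open scoped BigOperators
open Metric Set

namespace Summit.QuantumFields.BalabanUV.T4Continuum.B13StepOfRecordSub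

open Literature.MathematicalPhysics.QuantumFieldTheory.Balaban1983to89
open Literature.MathematicalPhysics.QuantumFieldTheory.Balaban1983to89.T4OutputRate (Carriers Functional DecayBound)
open Literature.MathematicalPhysics.QuantumFieldTheory.Balaban1983to89.T4InputCauchyRateData (StepModel)
open Summit.QuantumFields.BalabanUV.T4Continuum.B13Carriers (TwoRuns)
open Summit.QuantumFields.BalabanUV.T4Continuum.B13OpDatum (Format OpDatum Species FormatBounded)
open Summit.QuantumFields.BalabanUV.T4Continuum.B13OpDatumJunctions (opOf RawBounded WeightedEntrywiseRate)
open Summit.QuantumFields.BalabanUV.T4Continuum.B13HistInsertion (InsDatum)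
open Summit.QuantumFields.BalabanUV.T4Continuum.B13StepTermLabels (TermIdx InnerLabel termLabels)
open Summit.QuantumFields.BalabanUV.T4Continuum.B13StepTermFamily (term out)
open Summit.QuantumFields.BalabanUV.T4Continuum.B13StepTermSocket (labelsIndexing touchInc)
open Summit.QuantumFields.BalabanUV.T4Continuum.B13InnerData (Bnd b13InnerData)
open Summit.QuantumFields.BalabanUV.T4Continuum.B13BaseInsDatum (SliceBudgetAt)
open Summit.QuantumFields.BalabanUV.T4Continuum.B13RepresentsOn (AssemblyOn)
open Summit.QuantumFields.BalabanUV.T4Continuum.B13StepOfRecord (Slots assembly step)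
open Summit.QuantumFields.BalabanUV.T4Continuum.B13OpMeasurable (measOp assemble_mem_measOp)

variable {G : Type} [GaugeGroup G] (R : TwoRuns G)

/-! ## §1 The slots and the step model of record over an arbitrary operator carrier -/

/-- [folklore] DATA (no inequality inside): THE SLOTS OF THE INSTANCE OF RECORD OVER AN ARBITRARY OPERATOR CARRIER `Op` (R20) —
the (2.14)-activity terms reading the operator input in `Op`, the two runs' operator data IN `Op` (run A's on RUN-A backgrounds),
the insertion datum, the margins.  NAMED PARAMETERS (nothing of [II] identified here). -/
structure SlotsOn (R : TwoRuns G) (Op IOp Hist : Type*) [NormedAddCommGroup Op] [NormedSpace ℂ Op] [NormedAddCommGroup Hist]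
    [NormedSpace ℂ Hist] where
  /-- the (2.14)-activity terms localized at a polymer with an inner label, operator input in `Op` -/
  act : R.carriers.Dom → InnerLabel R.carriers.Dom (Bnd R) → Op → Hist → ℂ
  /-- run A's operator data at a run-A background -/
  opA : (ℕ → ℝ) → R.carriers.BgA → ℕ → Op
  /-- run B's operator data -/
  opB : (ℕ → ℝ) → R.carriers.BgB → ℕ → Op
  /-- the insertion datum -/
  D : InsDatum R.carriers IOp Hist
  /-- operator margin -/
  rOp : ℕ → ℝ
  /-- history margin -/
  rHist : ℕ → ℝ
  rOp_pos : ∀ k, 0 < rOp k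
  rHist_pos : ∀ k, 0 < rHist k

variable {R} {Op IOp Hist : Type*} [NormedAddCommGroup Op] [NormedSpace ℂ Op] [NormedAddCommGroup Hist] [NormedSpace ℂ Hist]
  (S : SlotsOn R Op IOp Hist)

/-- [folklore] **THE ASSEMBLY OF RECORD OVER `Op`**: term indexing := `labelsIndexing (domainGeometry R) (b13InnerData R)`, hard core :=
`touchInc (domainGeometry R)` (both OF RECORD, as in `B13StepOfRecord.assembly`), the analytic slots from `S`. -/
def assemblyOn : AssemblyOn R.carriers Op IOp Hist (TermIdx R.carriers.Dom (Bnd R)) R.carriers.Dom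
    (InnerLabel R.carriers.Dom (Bnd R)) where
  𝒯 := labelsIndexing (B13DomainGeometryTR.domainGeometry R) (b13InnerData R)
  inc := touchInc (B13DomainGeometryTR.domainGeometry R)
  decInc := inferInstance
  act := S.act
  opA := S.opA
  opB := S.opB
  D := S.D
  rOp := S.rOp
  rHist := S.rHist
  rOp_pos := S.rOp_pos
  rHist_pos := S.rHist_pos

/-- [folklore] **THE STEP MODEL OF RECORD OVER `Op`** at one-run level `E₀` and B-side slice constant `cB`. -/
def stepOn (E₀ cB : ℝ) : StepModel R.carriers Op Hist := (assemblyOn S).stepOn ((assemblyOn S).bHist E₀ cB)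

/-- [folklore] Run A's output (the recursion, `StepRecursion.recA`). -/
def outA (E₀ cB : ℝ) : Functional R.carriers R.carriers.BgA := (assemblyOn S).outA ((assemblyOn S).bHist E₀ cB)

/-- [folklore] Run B's output (`StepRecursion.recB`). -/
def outB (E₀ cB : ℝ) : Functional R.carriers R.carriers.BgB := (assemblyOn S).outB ((assemblyOn S).bHist E₀ cB)

variable (E₀ cB : ℝ)

/-- [folklore] The output functional IS leaf-08's `out` on the indexing and hard core OF RECORD (`rfl`) — the shape `M.Out = out 𝒯 inc
act` every polymorphic END producer consumes. -/
theorem stepOn_Out : (stepOn S E₀ cB).Out =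
    out (labelsIndexing (B13DomainGeometryTR.domainGeometry R) (b13InnerData R))
      (touchInc (B13DomainGeometryTR.domainGeometry R)) S.act := rfl

/-- [folklore] The operator data: run A read AT THE TRANSPORTED background, run B at its own (`rfl`). -/
theorem stepOn_opA (g : ℕ → ℝ) (U : R.carriers.BgB) (k : ℕ) :
    (stepOn S E₀ cB).opA g U k = S.opA g (R.carriers.transport U) k := rfl
/-- [folklore] -/
theorem stepOn_opB : (stepOn S E₀ cB).opB = S.opB := rfl
/-- [folklore] -/
theorem stepOn_insA : (stepOn S E₀ cB).insA = S.D.insA := rfl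
/-- [folklore] -/
theorem stepOn_insB : (stepOn S E₀ cB).insB = S.D.insB := rfl
/-- [folklore] -/
theorem stepOn_rOp : (stepOn S E₀ cB).rOp = S.rOp := rfl
/-- [folklore] -/
theorem stepOn_rHist : (stepOn S E₀ cB).rHist = S.rHist := rfl

/-- [folklore] **L02 on the carriers of record over `Op`, hypothesis-free.** -/
theorem representsB (W : Set (ℕ → ℝ)) : (stepOn S E₀ cB).RepresentsB (outB S E₀ cB) W := (assemblyOn S).representsB _ W

/-- [folklore] **L01 on the carriers of record over `Op`**, under the transport reading of run A's insertion-operator data. -/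
theorem representsA {W : Set (ℕ → ℝ)} (hT : (assemblyOn S).TransportReads W) :
    (stepOn S E₀ cB).RepresentsA (outA S E₀ cB) W :=
  (assemblyOn S).representsA _ hT

/-- [folklore] L02 is definitional: any represented run-B functional IS `outB` on the window. -/
theorem eq_outB {W : Set (ℕ → ℝ)} {EB : Functional R.carriers R.carriers.BgB} (hEB : (stepOn S E₀ cB).RepresentsB EB W)
    {g : ℕ → ℝ} (hg : g ∈ W) (U : R.carriers.BgB) (X : R.carriers.Dom) : EB g U X = outB S E₀ cB g U X :=
  (assemblyOn S).eq_outB _ hEB hg U X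

/-- [folklore] L01 is definitional (at transported backgrounds). -/
theorem eq_outA {W : Set (ℕ → ℝ)} (hT : (assemblyOn S).TransportReads W) {EA : Functional R.carriers R.carriers.BgA}
    (hEA : (stepOn S E₀ cB).RepresentsA EA W) {g : ℕ → ℝ} (hg : g ∈ W) (U : R.carriers.BgB) (X : R.carriers.Dom) :
    EA g (R.carriers.transport U) X = outA S E₀ cB g (R.carriers.transport U) X :=
  (assemblyOn S).eq_outA _ hT hEA hg U X

variable {S E₀ cB} in
/-- [folklore] **L03 on the carriers of record over `Op`** from the displayed B-side slice budget, the quoted one-run level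
`DecayBound EB W E₀ κ` (leaf L06, [Balaban1987RG1] (1.18) p. 263 — SHAPE, c4) and the signs. -/
theorem inBase {W : Set (ℕ → ℝ)} {κ : ℝ} {EB : Functional R.carriers R.carriers.BgB} (hb : (assemblyOn S).SliceBudgetB W κ cB)
    (hdB : DecayBound EB W E₀ κ) (hE₀ : 0 ≤ E₀) (hcB : 0 ≤ cB) (hω : 0 ≤ S.D.ω) (hω1 : S.D.ω < 1) :
    (stepOn S E₀ cB).InBase EB W :=
  AssemblyOn.inBase hb hdB hE₀ hcB hω hω1

/-- [folklore] The B-side slice budget IS O1-f part 2's `SliceBudgetAt … D.insOpB` (definitionally). -/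
theorem sliceBudgetB_iff (W : Set (ℕ → ℝ)) (κ : ℝ) :
    (assemblyOn S).SliceBudgetB W κ cB ↔ SliceBudgetAt S.D (stepOn S E₀ cB) W κ cB S.D.insOpB := Iff.rfl

/-- [folklore] The three run-A structure binders and the run-B blindness (row O1-c by name). -/
theorem structure_binders (W : Set (ℕ → ℝ)) :
    (stepOn S E₀ cB).InsAffine W ∧ (stepOn S E₀ cB).InsBlind W ∧ (stepOn S E₀ cB).InsHomog W ∧
      StepRecursion.InsBlindB (stepOn S E₀ cB) W :=
  ⟨(assemblyOn S).insAffine _ W, (assemblyOn S).insBlind _ W, (assemblyOn S).insHomog _ W, (assemblyOn S).insBlindB _ W⟩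

/-- [folklore] ROOM ⟹ SLACK on the carriers of record over `Op` (the class on which W2 is displayed). -/
theorem boxInClass (W : Set (ℕ → ℝ)) {ROp RHist : ℕ → ℝ} (hOp : ∀ k, S.rOp k ≤ ROp k)
    (hHist : ∀ k, (assemblyOn S).bHist E₀ cB k + S.rHist k ≤ RHist k) :
    T4InputCauchyRateSpecies.BoxInClass (stepOn S E₀ cB)
      (T4InputCauchyRateSpecies.ballClass (B13Base.selfCtr (assemblyOn S).raw (assemblyOn S).histRef) ROp RHist) W :=
  (assemblyOn S).boxInClass _ W hOp hHist

/-- [folklore] **THE OUTPUT BY LEVELS** (leaf-02's socket `out_eq_levelwise`, instantiated over `Op`). -/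
theorem out_eq_levelwise {k : ℕ} {X : R.carriers.Dom} (o : Op) (h : Hist)
    (hsum : Summable fun n => ∑ t ∈ termLabels (B13DomainGeometryTR.domainGeometry R) (b13InnerData R) k X n,
      ‖term (labelsIndexing (B13DomainGeometryTR.domainGeometry R) (b13InnerData R))
        (touchInc (B13DomainGeometryTR.domainGeometry R)) S.act k ⟨n, t⟩ o h X‖) :
    (stepOn S E₀ cB).Out k o h X =
      ∑' n, ∑ t ∈ termLabels (B13DomainGeometryTR.domainGeometry R) (b13InnerData R) k X n,
        term (labelsIndexing (B13DomainGeometryTR.domainGeometry R) (b13InnerData R))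
          (touchInc (B13DomainGeometryTR.domainGeometry R)) S.act k ⟨n, t⟩ o h X :=
  B13StepTermSocket.out_eq_levelwise _ _ S.act o h hsum

/-! ## §2 The slots of record on a sub-slot `M ≤ OpDatum E` containing the operator data of record -/

section OnSub

variable {E : Type*} (S₀ : Slots R E IOp Hist) (M : Submodule ℂ (OpDatum E))
  (hA : ∀ g V k, opOf S₀.F S₀.rawA g V k ∈ M) (hB : ∀ g U k, opOf S₀.F S₀.rawB g U k ∈ M)

/-- [folklore] **THE SLOTS OF RECORD ON THE SUB-SLOT `M`** with cores `act` typed ON `↥M`: the operator data of record `opOf F rawA`∕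
`opOf F rawB` coerced into `M` (side conditions `hA`∕`hB`), insertion datum and margins of record. -/
def onSub (act : R.carriers.Dom → InnerLabel R.carriers.Dom (Bnd R) → M → Hist → ℂ) : SlotsOn R M IOp Hist where
  act := act
  opA g V k := ⟨opOf S₀.F S₀.rawA g V k, hA g V k⟩
  opB g U k := ⟨opOf S₀.F S₀.rawB g U k, hB g U k⟩
  D := S₀.D
  rOp := S₀.rOp
  rHist := S₀.rHist
  rOp_pos := S₀.rOp_pos
  rHist_pos := S₀.rHist_pos

/-- [folklore] **THE SLOTS OF RECORD RESTRICTED TO `M`**: cores := `S₀.act` read through the inclusion `↥M → OpDatum E`. -/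
def restrict : SlotsOn R M IOp Hist := onSub S₀ M hA hB fun Z ℓ o h => S₀.act Z ℓ (o : OpDatum E) h

variable (act : R.carriers.Dom → InnerLabel R.carriers.Dom (Bnd R) → M → Hist → ℂ) (E₀ cB : ℝ)

/-- [folklore] The fields of the slots on the sub-slot (all `rfl`): cores as given, insertion datum and margins OF RECORD. -/
@[simp] theorem onSub_act : (onSub S₀ M hA hB act).act = act := rfl
/-- [folklore] -/ @[simp] theorem onSub_D : (onSub S₀ M hA hB act).D = S₀.D := rfl
/-- [folklore] -/ @[simp] theorem onSub_rOp : (onSub S₀ M hA hB act).rOp = S₀.rOp := rfl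
/-- [folklore] -/ @[simp] theorem onSub_rHist : (onSub S₀ M hA hB act).rHist = S₀.rHist := rfl
/-- [folklore] The restricted cores are `S₀.act` read through the inclusion `M.subtypeL` (`rfl`). -/
theorem restrict_act (Z : R.carriers.Dom) (ℓ : InnerLabel R.carriers.Dom (Bnd R)) (o : M) (h : Hist) :
    (restrict S₀ M hA hB).act Z ℓ o h = S₀.act Z ℓ (M.subtypeL o) h := rfl

/-- [folklore] THE READING RETURNS THE DATA OF RECORD, run A (`rfl`): `subtypeL (opA g V k) = opOf F rawA g V k`. -/
theorem subtypeL_opA (g : ℕ → ℝ) (V : R.carriers.BgA) (k : ℕ) :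
    M.subtypeL ((onSub S₀ M hA hB act).opA g V k) = opOf S₀.F S₀.rawA g V k := rfl

/-- [folklore] … run B (`rfl`). -/
theorem subtypeL_opB (g : ℕ → ℝ) (U : R.carriers.BgB) (k : ℕ) :
    M.subtypeL ((onSub S₀ M hA hB act).opB g U k) = opOf S₀.F S₀.rawB g U k := rfl

/-- [folklore] The model's operator data, coerced back, ARE those of the model of record (`rfl`). -/
theorem coe_stepOn_opA (g : ℕ → ℝ) (U : R.carriers.BgB) (k : ℕ) :
    ((stepOn (onSub S₀ M hA hB act) E₀ cB).opA g U k : OpDatum E) = (step S₀ E₀ cB).opA g U k := rfl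

/-- [folklore] -/
theorem coe_stepOn_opB (g : ℕ → ℝ) (U : R.carriers.BgB) (k : ℕ) :
    ((stepOn (onSub S₀ M hA hB act) E₀ cB).opB g U k : OpDatum E) = (step S₀ E₀ cB).opB g U k := rfl

/-- [folklore] The inclusion does not contract norms (it is an isometry): §4 of `B13RepresentsOn` applies with `rd := M.subtypeL`. -/
theorem norm_le_norm_subtypeL (z : M) : ‖z‖ ≤ ‖M.subtypeL z‖ := le_of_eq (Submodule.coe_norm z)

/-- [folklore] The history radius of record is unchanged (`rfl`). -/
theorem bHist_onSub : (assemblyOn (onSub S₀ M hA hB act)).bHist = (assembly S₀).bHist := rfl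

/-- [folklore] The history reference is unchanged (`rfl`). -/
theorem histRef_onSub : (assemblyOn (onSub S₀ M hA hB act)).histRef = (assembly S₀).histRef := rfl

/-- [folklore] The transport reading is that of the assembly of record (`Iff.rfl`). -/
theorem transportReads_onSub_iff (W : Set (ℕ → ℝ)) :
    (assemblyOn (onSub S₀ M hA hB act)).TransportReads W ↔ (assembly S₀).TransportReads W := Iff.rfl

/-- [folklore] The displayed run-B slice budget is that of the assembly of record (`Iff.rfl`). -/
theorem sliceBudgetB_onSub_iff (W : Set (ℕ → ℝ)) (κ c : ℝ) :
    (assemblyOn (onSub S₀ M hA hB act)).SliceBudgetB W κ c ↔ (assembly S₀).SliceBudgetB W κ c := Iff.rfl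

/-- [folklore] The displayed run-A slice budget is that of the model of record (`Iff.rfl`). -/
theorem sliceBudget_onSub_iff (W : Set (ℕ → ℝ)) (κ c : ℝ) :
    S₀.D.SliceBudget (stepOn (onSub S₀ M hA hB act) E₀ cB) W κ c ↔ S₀.D.SliceBudget (step S₀ E₀ cB) W κ c := Iff.rfl

/-- [folklore] W4 is that of the model of record (`Iff.rfl`: insertions and history margins unchanged). -/
theorem insertionRate_onSub_iff (W : Set (ℕ → ℝ)) (κ E₁ δ' θ : ℝ) :
    (stepOn (onSub S₀ M hA hB act) E₀ cB).InsertionRate W κ E₁ δ' θ ↔ (step S₀ E₀ cB).InsertionRate W κ E₁ δ' θ := Iff.rfl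

/-- [folklore] W3 is that of the model of record (`Iff.rfl`). -/
theorem insScaleBound_onSub_iff (W : Set (ℕ → ℝ)) (κ E₁ c ω : ℝ) :
    (stepOn (onSub S₀ M hA hB act) E₀ cB).InsScaleBound W κ E₁ c ω ↔ (step S₀ E₀ cB).InsScaleBound W κ E₁ c ω := Iff.rfl

/-- [folklore] **W1 TRANSFERS BOTH WAYS** along the isometric inclusion (`OperatorRate` in the norm of `↥M` = in the norm of `OpDatum E`). -/
theorem operatorRate_onSub_iff (W : Set (ℕ → ℝ)) (δ θ : ℝ) :
    (stepOn (onSub S₀ M hA hB act) E₀ cB).OperatorRate W δ θ ↔ (step S₀ E₀ cB).OperatorRate W δ θ := by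
  refine forall₄_congr fun k g _ U => ?_
  rw [Submodule.coe_norm, Submodule.coe_sub]
  rfl

/-- [folklore] **W1 ON THE SUB-SLOT FROM ROW NE2's ENTRY CURRENCY** (R20: «W1 readings transfer along `rd`»): bounded raw suppliers,
the weighted entrywise two-run rate `c₁·θ^k` between run A's species AT THE TRANSPORTED BACKGROUND and run B's (DISPLAYED) and the
margin floor `r₀` ⟹ `OperatorRate W (c₁∕r₀) θ` for the model on `↥M` — `B13RepresentsOn.AssemblyOn.operatorRate_of_reading` with
`rd := M.subtypeL`. -/
theorem operatorRate_onSub_of_weightedEntrywise {W : Set (ℕ → ℝ)} {c₁ θ r₀ : ℝ} (hRA : RawBounded S₀.F (assembly S₀).rawAt W)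
    (hRB : RawBounded S₀.F S₀.rawB W) (hwer : WeightedEntrywiseRate S₀.F (assembly S₀).rawAt S₀.rawB W c₁ fun k => θ ^ k)
    (hc₁ : 0 ≤ c₁) (hθ : 0 ≤ θ) (hfl : ∀ k, r₀ ≤ S₀.rOp k) (hr₀ : 0 < r₀) :
    (stepOn (onSub S₀ M hA hB act) E₀ cB).OperatorRate W (c₁ / r₀) θ :=
  AssemblyOn.operatorRate_of_reading (𝔄 := assemblyOn (onSub S₀ M hA hB act)) M.subtypeL (norm_le_norm_subtypeL M)
    (F := S₀.F) (rawA := S₀.rawA) (rawB := S₀.rawB) (fun _ _ _ => rfl) (fun _ _ _ => rfl) hRA hRB hwer hc₁ hθ hfl hr₀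

/-- [folklore] **THE BUDGET-BOX BASE CORRESPONDS UNDER THE INCLUSION**: a point `(o, h)` of `↥M × Hist` is a base point of the model
on the sub-slot iff `(↑o, h)` is a base point of the model of record (same centre — run B's own data, which lie in `M` —, same radii). -/
theorem mem_base_onSub_iff (k : ℕ) (g : ℕ → ℝ) (U : R.carriers.BgB) (o : M) (h : Hist) :
    (o, h) ∈ (stepOn (onSub S₀ M hA hB act) E₀ cB).Base k g U ↔ ((o : OpDatum E), h) ∈ (step S₀ E₀ cB).Base k g U := by
  change (o, h) ∈ closedBall _ _ ×ˢ closedBall _ _ ↔ ((o : OpDatum E), h) ∈ closedBall _ _ ×ˢ closedBall _ _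
  simp only [mem_prod, mem_closedBall, Subtype.dist_eq]
  exact Iff.rfl

/-- [folklore] **THE BUDGET BALL CLASS CORRESPONDS UNDER THE INCLUSION**: the self-centred two-margin class of the model on the
sub-slot (radii `ROp`, `RHist`) — the family of subsets of `↥M × Hist` on which W2 is DISPLAYED for it — is the preimage of the
class of the model of record.  (So an operator-ball binder over it quantifies over directions IN `M` only: R20.) -/
theorem mem_ballClass_onSub_iff (ROp RHist : ℕ → ℝ) (k : ℕ) (g : ℕ → ℝ) (U : R.carriers.BgB) (o : M) (h : Hist) :
    (o, h) ∈ T4InputCauchyRateSpecies.ballClass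
        (B13Base.selfCtr (assemblyOn (onSub S₀ M hA hB act)).raw (assemblyOn (onSub S₀ M hA hB act)).histRef) ROp RHist k g U ↔
      ((o : OpDatum E), h) ∈ T4InputCauchyRateSpecies.ballClass
        (B13Base.selfCtr (assembly S₀).raw (assembly S₀).histRef) ROp RHist k g U := by
  simp only [T4InputCauchyRateSpecies.ballClass, mem_prod, mem_closedBall, Subtype.dist_eq]
  exact Iff.rfl

/-- [folklore] **RESTRICTED CORES: THE OUTPUT FUNCTIONAL IS THE RECORD's READ THROUGH THE INCLUSION** (`rfl`). -/
theorem stepOn_restrict_Out (k : ℕ) (o : M) (h : Hist) (X : R.carriers.Dom) :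
    (stepOn (restrict S₀ M hA hB) E₀ cB).Out k o h X = (step S₀ E₀ cB).Out k (o : OpDatum E) h X := rfl

/-- [folklore] **RESTRICTED CORES: RUN B's OUTPUT IS RUN B's OUTPUT OF RECORD** — the recursion (2.13) reads `Out` only at the model's
own run-B operator data, which lie in `M` (`rfl`). -/
theorem outB_restrict : outB (restrict S₀ M hA hB) E₀ cB = B13StepOfRecord.outB S₀ E₀ cB := rfl

/-- [folklore] **RESTRICTED CORES: RUN A's OUTPUT IS RUN A's OUTPUT OF RECORD** (`rfl`). -/
theorem outA_restrict : outA (restrict S₀ M hA hB) E₀ cB = B13StepOfRecord.outA S₀ E₀ cB := rfl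

end OnSub

/-! ## §3 Of record (R20): the measurable operator slot `measOp` -/

section MeasOp

variable {T κ ι Ω 𝒴 : Type*} [MeasurableSpace Ω] (S₀ : Slots R (Species T κ ι Ω 𝒴) IOp Hist)

/-- [folklore] **RUN A's OPERATOR DATA OF RECORD LIE IN THE MEASURABLE SLOT** when run A's raw species are format-bounded with
measurable `x`-sections on the two potential species and the formats' potential weights are measurable in `x` (one-run side
conditions of printed KIND; route P2's `assemble_mem_measOp` BY NAME). -/
theorem opA_mem_measOp (hbd : ∀ g V k, FormatBounded (S₀.F k) (S₀.rawA g V k))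
    (hrawQ : ∀ g V k (Y : 𝒴) (b b' : κ), Measurable fun x : Ω => S₀.rawA g V k (.potQ x Y b b'))
    (hrawR : ∀ g V k (Y : 𝒴), Measurable fun x : Ω => S₀.rawA g V k (.potR x Y))
    (hFQ : ∀ k (Y : 𝒴) (b b' : κ), Measurable fun x : Ω => (S₀.F k).wt (.potQ x Y b b'))
    (hFR : ∀ k (Y : 𝒴), Measurable fun x : Ω => (S₀.F k).wt (.potR x Y)) (g : ℕ → ℝ) (V) (k : ℕ) :
    opOf S₀.F S₀.rawA g V k ∈ measOp T κ ι Ω 𝒴 :=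
  assemble_mem_measOp (S₀.F k) (hbd g V k) (hrawQ g V k) (hrawR g V k) (hFQ k) (hFR k)

/-- [folklore] **RUN B's OPERATOR DATA OF RECORD LIE IN THE MEASURABLE SLOT** under the same one-run side conditions on run B. -/
theorem opB_mem_measOp (hbd : ∀ g U k, FormatBounded (S₀.F k) (S₀.rawB g U k))
    (hrawQ : ∀ g U k (Y : 𝒴) (b b' : κ), Measurable fun x : Ω => S₀.rawB g U k (.potQ x Y b b'))
    (hrawR : ∀ g U k (Y : 𝒴), Measurable fun x : Ω => S₀.rawB g U k (.potR x Y))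
    (hFQ : ∀ k (Y : 𝒴) (b b' : κ), Measurable fun x : Ω => (S₀.F k).wt (.potQ x Y b b'))
    (hFR : ∀ k (Y : 𝒴), Measurable fun x : Ω => (S₀.F k).wt (.potR x Y)) (g : ℕ → ℝ) (U) (k : ℕ) :
    opOf S₀.F S₀.rawB g U k ∈ measOp T κ ι Ω 𝒴 :=
  assemble_mem_measOp (S₀.F k) (hbd g U k) (hrawQ g U k) (hrawR g U k) (hFQ k) (hFR k)

variable (hA : ∀ g V k, opOf S₀.F S₀.rawA g V k ∈ measOp T κ ι Ω 𝒴) (hB : ∀ g U k, opOf S₀.F S₀.rawB g U k ∈ measOp T κ ι Ω 𝒴)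

/-- [folklore] **THE SLOTS OF RECORD ON THE MEASURABLE SLOT** (R20's operator carrier OF RECORD `Op′ := ↥measOp`, `rd := subtypeL`)
with cores typed on `↥measOp` — where leaf-08's `B13TermDataOpSecantM` and the O1-d2-ii instance (R18) are to live. -/
def onMeasOp (act : R.carriers.Dom → InnerLabel R.carriers.Dom (Bnd R) → measOp T κ ι Ω 𝒴 → Hist → ℂ) :
    SlotsOn R (measOp T κ ι Ω 𝒴) IOp Hist :=
  onSub S₀ (measOp T κ ι Ω 𝒴) hA hB act

/-- [folklore] The slots of record RESTRICTED to the measurable slot (cores := `S₀.act` through the inclusion); its outputs are the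
outputs of record (`outA_restrict`∕`outB_restrict`). -/
def restrictMeasOp : SlotsOn R (measOp T κ ι Ω 𝒴) IOp Hist := restrict S₀ (measOp T κ ι Ω 𝒴) hA hB

/-- [folklore] The outputs of the restricted model of record ARE the outputs of record (`rfl`). -/
theorem outB_restrictMeasOp (E₀ cB : ℝ) : outB (restrictMeasOp S₀ hA hB) E₀ cB = B13StepOfRecord.outB S₀ E₀ cB := rfl

/-- [folklore] -/
theorem outA_restrictMeasOp (E₀ cB : ℝ) : outA (restrictMeasOp S₀ hA hB) E₀ cB = B13StepOfRecord.outA S₀ E₀ cB := rfl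

end MeasOp

end Summit.QuantumFields.BalabanUV.T4Continuum.B13StepOfRecordSub

end
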